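import Mathlib
import HarnessLib
import Summits.HubbardSuperconductivity.HubbardSuperconductivity.Theorems.KLProgrammeKLRegimeEngineV8DefsQ3
import Summits.HubbardSuperconductivity.HubbardSuperconductivity.Theorems.KLProgrammeKLRegimeSplitSpin01

/-!
# The isotropic torus bound of the K3 engine's scale-`0` rung: the named statement `IsoTorusBoundAt T` and the closed constant `klIsoT`

Cell `gate-hubbard-kl`, seat p3 g6 (DefsG4 author / scale-`0` assembler of record, plan g13 (R7)/(R9), l.1930/l.1956).  The (E5-S)₀
closer `isoTupleL1AtS_zero_of_klEngU₀3` (p495210) and the scale-`0` assembly `engineScaleZero_klEngQ5_of` (p495704) take ONE analytic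
input beyond (E4)₀: a uniform torus `ℓ¹` bound `Th / imagTimeWeight β M` for the space–time character sums of every isotropic sector
multiplier `klIsoFamily L M β μ K klE0 m ω` on the padded `(ℤ/4M) × (ℤ/L)²` grid (p4 g7's lane, files (J1)–(J3)).  This file NAMES that
input so that the `G`-package swap (`klEngGeo4 := klEngGeo3.raise (klIsoT ^ 4) _`, …EngineV8DefsG4) and the registrant's re-registration do
not wait on the proof:

* **`IsoTorusBoundAt T`** — the bound with constant `T`, under EXACTLY the binders of `stub_engine_scale0`
  (`P.WF`, `R.WF2`, `0 < c ≤ klEngC₃3 P R`, `μ ∈ klWindowC`, `0 < U ≤ klEngU₀3 P R c`, `klBetaMin ≤ β ≤ e^{c/U²}`, `FrameOK R U (nScales β) μ K`,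
  `klEngL₃ β U ≤ L`, `klEngM₃ β U L ≤ M`), for every radial scale `m`, angular index `ω` and charge `c'` — literally the hypothesis `hT`
  of `isoTupleL1AtS_zero_of_klEngU₀3`;
* what (J3) proves is `IsoTorusBoundAt T̂` for p4 g7's closed constant `T̂ ≥ 0` (any name);
* **`klIsoT := if h : (∃ T, 0 ≤ T ∧ IsoTorusBoundAt T) then Classical.choose h else 0`** (classical `if`) — THE engine's isotropic torus
  constant, a CLOSED term (no staged binder): `klIsoT_nonneg`, and **`isoTorusBoundAt_klIsoT : 0 ≤ T → IsoTorusBoundAt T → IsoTorusBoundAt klIsoT`**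
  (any witness makes `klIsoT` a bound), `IsoTorusBoundAt.mono` (a larger constant is still a bound).  Downstream (DefsG4, the (E5-S)₀
  corollary, the `stub_engine_scale0` assembly) refers to `klIsoT` only, so it does not depend on the name or the size of p4's constant.

No analysis here; the content is p4's (J1)–(J3).
-/

namespace Summit.HubbardSuperconductivity.HubbardSuperconductivity.Theorems.EngineV8

noncomputable section

open Real Finset Literature.MathematicalPhysics.QuantumLattice Literature.Probability.LatticeModels
open Summit.HubbardSuperconductivity.HubbardSuperconductivity.Theorems.KLRegimeSplit
open Summit.HubbardSuperconductivity.HubbardSuperconductivity.Theorems.KLProgrammeLegKernels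
open scoped ComplexConjugate

/-- **`IsoTorusBoundAt T`** — the uniform torus `ℓ¹` bound, with constant `T`, of the space–time character sums of the isotropic sector
multipliers `klIsoFamily L M β μ K klE0 m ω` on the padded `(ℤ/4M) × (ℤ/L)²` grid, under exactly the binders of `stub_engine_scale0`:
`(1/(|β|L²))·Σ_{(t,x)} ‖Σ_k klIso_{m,ω}(k)·Χ_{c'}(k;(t,x))‖ ≤ T / imagTimeWeight β M` for every `m, ω, c'`. -/
def IsoTorusBoundAt (T : ℝ) : Prop :=
  ∀ (P : SplitConsts) (R : RenConsts) (c : ℝ), P.WF → R.WF2 → 0 < c → c ≤ klEngC₃3 P R → ∀ μ ∈ klWindowC, ∀ U : ℝ, 0 < U →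
    U ≤ klEngU₀3 P R c → ∀ β : ℝ, klBetaMin ≤ β → β ≤ Real.exp (c / U ^ 2) → ∀ K : TrigPolyC4v, FrameOK R U (nScales β) μ K →
    ∀ (L M : ℕ) [NeZero L] [NeZero M], klEngL₃ β U ≤ L → klEngM₃ β U L ≤ M →
    ∀ (m : ℕ) (ω : Fin (sectorCount (2 * m))) (c' : Fin 2), 1 / (|β| * (L : ℝ) ^ 2) *
        ∑ dw : TorusSite 1 (2 * (2 * M)) × TorusSite 2 L, ‖∑ k : FreqMomentum L M, klIsoFamily L M β μ K klE0 m ω k *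
          (if c' = 0 then torusChar (fun _ : Fin 1 => ((k.1 : ℕ) : ZMod (2 * (2 * M)))) dw.1 * torusChar k.2 dw.2
            else conj (torusChar (fun _ : Fin 1 => ((k.1 : ℕ) : ZMod (2 * (2 * M)))) dw.1 * torusChar k.2 dw.2))‖ ≤
        T / imagTimeWeight β M

open Classical in
/-- **`klIsoT`** — THE isotropic torus constant of the engine: a nonnegative witness of `IsoTorusBoundAt` when one exists, `0` otherwise
(a closed term; it enters the `G`-package as `CF := max klEngGeo3.CF (klIsoT ^ 4)`). -/
def klIsoT : ℝ := if h : (∃ T : ℝ, 0 ≤ T ∧ IsoTorusBoundAt T) then Classical.choose h else 0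

/-- `0 ≤ klIsoT`. -/
theorem klIsoT_nonneg : 0 ≤ klIsoT := by
  classical
  unfold klIsoT
  split_ifs with h
  · exact (Classical.choose_spec h).1
  · exact le_rfl

/-- **`klIsoT` IS a bound as soon as any nonnegative constant is** (the form in which (J3) is consumed). -/
theorem isoTorusBoundAt_klIsoT {T : ℝ} (hT0 : 0 ≤ T) (hT : IsoTorusBoundAt T) : IsoTorusBoundAt klIsoT := by
  classical
  have h : ∃ T : ℝ, 0 ≤ T ∧ IsoTorusBoundAt T := ⟨T, hT0, hT⟩
  have : klIsoT = Classical.choose h := by unfold klIsoT; exact dif_pos h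
  rw [this]
  exact (Classical.choose_spec h).2

/-- A larger constant is still a bound (`0 < β` in the regime, so `T / imagTimeWeight β M` is monotone in `T`). -/
theorem IsoTorusBoundAt.mono {T T' : ℝ} (h : IsoTorusBoundAt T) (hTT' : T ≤ T') : IsoTorusBoundAt T' := by
  intro P R c hP hR hc hc₃ μ hμ U hU hU₀ β hβ hβc K hK L M _ _ hL hM m ω c'
  refine (h P R c hP hR hc hc₃ μ hμ U hU hU₀ β hβ hβc K hK L M hL hM m ω c').trans ?_
  have hβ0 : 0 < β := lt_of_lt_of_le (by norm_num [klBetaMin]) hβ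
  have hM0 : (0 : ℝ) < M := Nat.cast_pos.2 (Nat.pos_of_ne_zero (NeZero.ne M))
  have hw : 0 < imagTimeWeight β M := by unfold imagTimeWeight; positivity
  exact div_le_div_of_nonneg_right hTT' hw.le

end

end Summit.HubbardSuperconductivity.HubbardSuperconductivity.Theorems.EngineV8
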